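import Summits.Ventures.HodgeRepro0.P5AprimeCensus

/-!
# P5AprimeCensusPieces — the balanced subsets of `(ℤ/96)^×` for the type `T′` of `A′`: pairs, cosets, the disjoint
decomposition and the primitive sets (kernel-checked)

p5 (g21), 2026-08-29.  Supporting artefact (R-5): finite combinatorics only; nothing here is an algebraicity statement.
Companion of `P5AprimeCensus.lean` (the block theorem `balanced_iff_blocks`), whose notation it continues: `units`,
`Tp`, `conj u = 96 − u`, `coset c = [c, 25c, 49c, 73c] mod 96`, `creps = [1, 5, 7, 11]`, `Balanced`, `PairsOn` /
`CosetOn` / `ConjCosetOn`.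

THEOREMS.  `balanced_decomposition`: every balanced `S ⊆ U` is a DISJOINT UNION of conjugate pairs `{s, −s}` and cosets
of `H = {1, 25, 49, 73}` (the census statement of the page of Theorem F′, proofs/P1-HCofAprime-v1.md §2 — the canonical
pieces `piecesOf S`: on each block `cH ∪ −cH` the coset `cH`, or `−cH`, or the pairs `{t, −t}`, `t ∈ cH ∩ S`).
`primitive_iff`: the PRIMITIVE balanced sets (non-empty, with no proper non-empty balanced subset) are exactly the 16
conjugate pairs (`IsPair`) and the 8 cosets of `H` (`IsCoset`) — the divisor classes and the exceptional orbit of `A′`.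
The blocks `block (crep i)`, `i : Fin 4`, partition the units (`block_cover`, `block_disj`); these facts are shared with
`P5AprimeCensusCount.lean`.
-/

namespace HodgeRepro0.P5AprimeCensus

/-! ### The blocks -/

/-- The block of `c`: the coset `cH` together with its conjugate `−cH`. -/
def block (c : ℕ) : Finset ℕ := (coset c).toFinset ∪ ((coset c).map conj).toFinset

/-- The `i`-th coset representative, `i : Fin 4`. -/
def crep (i : Fin 4) : ℕ := creps.getD i 0

/-- `crep i ∈ creps`, and every `c ∈ creps` is some `crep i`. -/
theorem crep_facts : (∀ i : Fin 4, crep i ∈ creps) ∧ (∀ c ∈ creps, ∃ i : Fin 4, c = crep i) := by decide +kernel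

/-- Coset elements and their conjugates lie in the block. -/
theorem block_mem : ∀ i : Fin 4, ∀ t ∈ coset (crep i), t ∈ block (crep i) ∧ conj t ∈ block (crep i) := by
  decide +kernel

/-- Distinct blocks are disjoint. -/
theorem block_disj : ∀ i j : Fin 4, i ≠ j → ∀ t ∈ block (crep i), t ∉ block (crep j) := by decide +kernel

/-- The blocks cover the units, and each block lies in `U`. -/
theorem block_cover : (∀ u ∈ units, ∃ i : Fin 4, u ∈ block (crep i)) ∧ (∀ i : Fin 4, block (crep i) ⊆ U) := by
  decide +kernel

/-! ### Pairs, cosets, and the primitive balanced sets -/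

/-- A conjugate pair `{s, −s}`, `s` a unit. -/
def IsPair (P : Finset ℕ) : Prop := ∃ s ∈ units, P = {s, conj s}

/-- A coset `cH` of `H = {1, 25, 49, 73}`, `c` a unit (eight cosets). -/
def IsCoset (P : Finset ℕ) : Prop := ∃ c ∈ units, P = (coset c).toFinset

/-- PRIMITIVE: balanced, non-empty, with no proper non-empty balanced subset. -/
def Primitive (S : Finset ℕ) : Prop := Balanced S ∧ S.Nonempty ∧ ∀ P ⊂ S, P.Nonempty → ¬ Balanced P

/-- Every conjugate pair is balanced. -/
theorem pair_balanced : ∀ s ∈ units, Balanced {s, conj s} := by decide +kernel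

/-- Every coset of `H` is balanced. -/
theorem coset_balanced : ∀ c ∈ units, Balanced (coset c).toFinset := by decide +kernel

/-- The conjugate of the coset `cH` is the coset `(−c)H`. -/
theorem coset_conj : ∀ c ∈ creps, ((coset c).map conj).toFinset = (coset (conj c)).toFinset := by decide +kernel

/-- Conjugates of representatives are units; `creps ⊆ units`. -/
theorem conj_units : (∀ c ∈ creps, conj c ∈ units) ∧ (∀ c ∈ creps, c ∈ units) := by decide +kernel

/-- Every representative lies in one of the four cosets. -/
theorem R_coset : ∀ t ∈ R, ∃ c ∈ creps, t ∈ coset c := by decide +kernel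

/-- Coset elements are units; a coset and its conjugate are disjoint; the conjugate is an involution on units. -/
theorem coset_facts : (∀ c ∈ creps, ∀ t ∈ coset c, t ∈ units) ∧ (∀ c ∈ creps, ∀ t ∈ coset c, conj t ∉ coset c) ∧
    (∀ u ∈ units, conj (conj u) = u) ∧ (∀ u ∈ units, u ≠ conj u) := by decide +kernel

/-- The coset of any unit is the coset of a representative or the conjugate of one. -/
theorem coset_of_unit : ∀ c ∈ units, ∃ c' ∈ creps,
    (coset c).toFinset = (coset c').toFinset ∨ (coset c).toFinset = ((coset c').map conj).toFinset := by
  decide +kernel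

/-- Cosets are subsets of `U`. -/
theorem coset_sub_U : ∀ c ∈ units, (coset c).toFinset ⊆ U := by decide +kernel

/-- Every unit lies in its own coset. -/
theorem coset_mem_self : ∀ c ∈ units, c ∈ (coset c).toFinset := by decide +kernel

/-- A set of odd cardinality is not balanced (`k = 1`). -/
theorem not_balanced_of_odd (S : Finset ℕ) (h : S.card % 2 = 1) : ¬ Balanced S := by
  intro hb
  have := hb 1 (by decide)
  omega

/-- A balanced non-empty `S ⊆ U` contains a balanced pair or coset. -/
theorem contains_piece (S : Finset ℕ) (hS : S ⊆ U) (hb : Balanced S) (hne : S.Nonempty) :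
    ∃ P ⊆ S, (IsPair P ∨ IsCoset P) ∧ P.Nonempty ∧ Balanced P := by
  obtain ⟨s, hs⟩ := hne
  have hsU : s ∈ units := List.mem_toFinset.mp (hS hs)
  -- the representative t₀ of the pair of s, with s = t₀ or s = conj t₀
  obtain ⟨t₀, ht₀R, hst⟩ : ∃ t₀ ∈ R, s = t₀ ∨ s = conj t₀ := by
    rcases R_facts.2.2.2.2.2 s hsU with h | ⟨t, ht, hst⟩
    · exact ⟨s, h, Or.inl rfl⟩
    · exact ⟨t, ht, Or.inr hst⟩
  obtain ⟨c, hc, htc⟩ := R_coset t₀ ht₀R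
  have ht₀U : t₀ ∈ units := coset_facts.1 c hc t₀ htc
  rcases (balanced_iff_blocks S hS).mp hb c hc with h1 | h1 | h1
  · -- pairs on the block: the pair of s lies in S
    refine ⟨{t₀, conj t₀}, ?_, Or.inl ⟨t₀, ht₀U, rfl⟩, ⟨t₀, by simp⟩, pair_balanced t₀ ht₀U⟩
    have hiff := h1 t₀ htc
    intro x hx
    rw [Finset.mem_insert, Finset.mem_singleton] at hx
    rcases hst with rfl | rfl
    · rcases hx with rfl | rfl
      · exact hs
      · exact hiff.mp hs
    · rcases hx with rfl | rfl
      · exact hiff.mpr hs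
      · exact hs
  · -- the coset cH lies in S
    refine ⟨(coset c).toFinset, ?_, Or.inr ⟨c, conj_units.2 c hc, rfl⟩, ⟨c, List.mem_toFinset.mpr (creps_mem_coset c hc)⟩,
      coset_balanced c (conj_units.2 c hc)⟩
    intro x hx
    exact (h1 x (List.mem_toFinset.mp hx)).1
  · -- the coset −cH lies in S
    refine ⟨((coset c).map conj).toFinset, ?_, Or.inr ⟨conj c, conj_units.1 c hc, coset_conj c hc⟩, ?_, ?_⟩
    · intro x hx
      rw [List.mem_toFinset, List.mem_map] at hx
      obtain ⟨t, ht, rfl⟩ := hx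
      exact (h1 t ht).2
    · exact ⟨conj c, List.mem_toFinset.mpr (List.mem_map.mpr ⟨c, creps_mem_coset c hc, rfl⟩)⟩
    · rw [coset_conj c hc]; exact coset_balanced _ (conj_units.1 c hc)

/-- A pair has at most two elements. -/
theorem pair_card (s : ℕ) : ({s, conj s} : Finset ℕ).card ≤ 2 := Finset.card_le_two

/-- No proper non-empty subset of a coset is balanced. -/
theorem coset_no_sub (c : ℕ) (hc : c ∈ units) (P : Finset ℕ) (hP : P ⊂ (coset c).toFinset) (hne : P.Nonempty) :
    ¬ Balanced P := by
  intro hb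
  have hPU : P ⊆ U := fun x hx => coset_sub_U c hc (hP.subset hx)
  obtain ⟨c', hc', hcc⟩ := coset_of_unit c hc
  have hcc' := creps_mem_coset c' hc'
  rcases hcc with hcc | hcc
  · rw [hcc] at hP
    rcases (balanced_iff_blocks P hPU).mp hb c' hc' with h1 | h1 | h1
    · -- pairs: no conjugate lies in the coset, so P is empty
      obtain ⟨x, hx⟩ := hne
      have hxc : x ∈ coset c' := List.mem_toFinset.mp (hP.subset hx)
      have : conj x ∈ P := (h1 x hxc).mp hx
      exact coset_facts.2.1 c' hc' x hxc (List.mem_toFinset.mp (hP.subset this))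
    · -- the whole coset lies in P: not proper
      apply hP.not_subset
      intro x hx
      exact (h1 x (List.mem_toFinset.mp hx)).1
    · -- a conjugate lies in P ⊆ cH: impossible
      have := (h1 c' hcc').2
      exact coset_facts.2.1 c' hc' c' hcc' (List.mem_toFinset.mp (hP.subset this))
  · rw [hcc] at hP
    have hmem : ∀ x ∈ P, ∃ t ∈ coset c', x = conj t := by
      intro x hx
      have := hP.subset hx
      rw [List.mem_toFinset, List.mem_map] at this
      obtain ⟨t, ht, rfl⟩ := this
      exact ⟨t, ht, rfl⟩
    rcases (balanced_iff_blocks P hPU).mp hb c' hc' with h1 | h1 | h1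
    · -- pairs: a coset element would lie in P, but P ⊆ −c'H
      obtain ⟨x, hx⟩ := hne
      obtain ⟨t, ht, rfl⟩ := hmem x hx
      have htP : t ∈ P := (h1 t ht).mpr hx
      obtain ⟨t', ht', htt⟩ := hmem t htP
      have htU := coset_facts.1 c' hc' t ht
      have ht'U := coset_facts.1 c' hc' t' ht'
      -- t = conj t' with t, t' ∈ c'H: then conj t = t' ∈ c'H, contradicting coset_facts
      have : conj t ∈ coset c' := by
        rw [htt, coset_facts.2.2.1 t' ht'U]; exact ht'
      exact coset_facts.2.1 c' hc' t ht this
    · -- c' ∈ P ⊆ −c'H: impossible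
      have := (h1 c' hcc').1
      obtain ⟨t', ht', htt⟩ := hmem c' this
      have h2 : conj c' = t' := by
        rw [htt]; exact coset_facts.2.2.1 t' (coset_facts.1 c' hc' t' ht')
      have : conj c' ∈ coset c' := by rw [h2]; exact ht'
      exact coset_facts.2.1 c' hc' c' hcc' this
    · -- the whole conjugate coset lies in P: not proper
      apply hP.not_subset
      intro x hx
      rw [List.mem_toFinset, List.mem_map] at hx
      obtain ⟨t, ht, rfl⟩ := hx
      exact (h1 t ht).2

/-- THE PRIMITIVE BALANCED SETS are exactly the 16 conjugate pairs and the 8 cosets of `H`. -/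
theorem primitive_iff (S : Finset ℕ) (hS : S ⊆ U) : Primitive S ↔ IsPair S ∨ IsCoset S := by
  constructor
  · rintro ⟨hb, hne, hmin⟩
    obtain ⟨P, hPS, hP, hPne, hPb⟩ := contains_piece S hS hb hne
    have : P = S := by
      by_contra hneq
      exact hmin P (Finset.ssubset_iff_subset_ne.mpr ⟨hPS, hneq⟩) hPne hPb
    rw [← this]; exact hP
  · rintro (⟨s, hs, rfl⟩ | ⟨c, hc, rfl⟩)
    · refine ⟨pair_balanced s hs, ⟨s, by simp⟩, ?_⟩
      intro P hP hPne
      apply not_balanced_of_odd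
      have h1 : 1 ≤ P.card := Finset.card_pos.mpr hPne
      have h2 : P.card < 2 := lt_of_lt_of_le (Finset.card_lt_card hP) (pair_card s)
      omega
    · exact ⟨coset_balanced c hc, ⟨c, coset_mem_self c hc⟩, coset_no_sub c hc⟩


/-! ### The disjoint decomposition into pairs and cosets -/

/-- The canonical pieces of `S` on the block of `crep i`: the coset `cH` if `S` contains it and not its conjugate,
the coset `−cH` in the opposite case, and otherwise the conjugate pairs `{t, −t}` with `t ∈ cH ∩ S`. -/
def blockPieces (S : Finset ℕ) (i : Fin 4) : Finset (Finset ℕ) :=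
  if CosetOn S (crep i) then {(coset (crep i)).toFinset}
  else if ConjCosetOn S (crep i) then {((coset (crep i)).map conj).toFinset}
  else ((coset (crep i)).toFinset.filter (fun t => t ∈ S)).image (fun t => {t, conj t})

/-- The canonical pieces of `S`. -/
def piecesOf (S : Finset ℕ) : Finset (Finset ℕ) := Finset.univ.biUnion (blockPieces S)

/-- Distinct conjugate pairs of one block are disjoint. -/
theorem pair_disj : ∀ i : Fin 4, ∀ t ∈ coset (crep i), ∀ t' ∈ coset (crep i), t ≠ t' →
    Disjoint ({t, conj t} : Finset ℕ) {t', conj t'} := by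
  decide +kernel

/-- Elements of the block of `crep i` are coset elements or conjugates of coset elements. -/
theorem mem_block (i : Fin 4) (x : ℕ) :
    x ∈ block (crep i) ↔ x ∈ coset (crep i) ∨ ∃ t ∈ coset (crep i), x = conj t := by
  unfold block
  rw [Finset.mem_union, List.mem_toFinset, List.mem_toFinset, List.mem_map]
  constructor
  · rintro (h | ⟨t, ht, rfl⟩)
    · exact Or.inl h
    · exact Or.inr ⟨t, ht, rfl⟩
  · rintro (h | ⟨t, ht, rfl⟩)
    · exact Or.inl h
    · exact Or.inr ⟨t, ht, rfl⟩

/-- Every piece on the block of `crep i` lies in that block. -/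
theorem piece_sub_block (S : Finset ℕ) (i : Fin 4) : ∀ P ∈ blockPieces S i, P ⊆ block (crep i) := by
  intro P hP
  unfold blockPieces at hP
  split_ifs at hP with h1 h2
  · rw [Finset.mem_singleton] at hP; rw [hP]; exact Finset.subset_union_left
  · rw [Finset.mem_singleton] at hP; rw [hP]; exact Finset.subset_union_right
  · rw [Finset.mem_image] at hP
    obtain ⟨t, ht, rfl⟩ := hP
    have ht' : t ∈ coset (crep i) := List.mem_toFinset.mp (Finset.mem_filter.mp ht).1
    intro x hx
    rw [Finset.mem_insert, Finset.mem_singleton] at hx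
    rcases hx with rfl | rfl
    · exact (block_mem i x ht').1
    · exact (block_mem i t ht').2

/-- Every canonical piece is a conjugate pair or a coset of `H`. -/
theorem pieces_are_pieces (S : Finset ℕ) : ∀ P ∈ piecesOf S, IsPair P ∨ IsCoset P := by
  intro P hP
  unfold piecesOf at hP
  rw [Finset.mem_biUnion] at hP
  obtain ⟨i, _, hP⟩ := hP
  have hci := crep_facts.1 i
  unfold blockPieces at hP
  split_ifs at hP with h1 h2
  · rw [Finset.mem_singleton] at hP; rw [hP]
    exact Or.inr ⟨crep i, conj_units.2 _ hci, rfl⟩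
  · rw [Finset.mem_singleton] at hP; rw [hP]
    exact Or.inr ⟨conj (crep i), conj_units.1 _ hci, coset_conj _ hci⟩
  · rw [Finset.mem_image] at hP
    obtain ⟨t, ht, rfl⟩ := hP
    have ht' : t ∈ coset (crep i) := List.mem_toFinset.mp (Finset.mem_filter.mp ht).1
    exact Or.inl ⟨t, coset_facts.1 _ hci t ht', rfl⟩

/-- The canonical pieces are pairwise disjoint. -/
theorem pieces_disjoint (S : Finset ℕ) : (piecesOf S : Set (Finset ℕ)).PairwiseDisjoint id := by
  intro P hP P' hP' hne
  rw [Finset.mem_coe, piecesOf, Finset.mem_biUnion] at hP hP'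
  obtain ⟨i, _, hPi⟩ := hP
  obtain ⟨j, _, hPj⟩ := hP'
  by_cases hij : i = j
  · subst hij
    have hci := crep_facts.1 i
    unfold blockPieces at hPi hPj
    split_ifs at hPi hPj with h1 h2
    · rw [Finset.mem_singleton] at hPi hPj; exact absurd (hPi.trans hPj.symm) hne
    · rw [Finset.mem_singleton] at hPi hPj; exact absurd (hPi.trans hPj.symm) hne
    · rw [Finset.mem_image] at hPi hPj
      obtain ⟨t, ht, rfl⟩ := hPi
      obtain ⟨t', ht', rfl⟩ := hPj
      have htc : t ∈ coset (crep i) := List.mem_toFinset.mp (Finset.mem_filter.mp ht).1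
      have htc' : t' ∈ coset (crep i) := List.mem_toFinset.mp (Finset.mem_filter.mp ht').1
      have htt : t ≠ t' := by rintro rfl; exact hne rfl
      exact pair_disj i t htc t' htc' htt
  · have h1 := piece_sub_block S i P hPi
    have h2 := piece_sub_block S j P' hPj
    show Disjoint P P'
    rw [Finset.disjoint_left]
    intro x hx hx'
    exact block_disj i j hij x (h1 hx) (h2 hx')

/-- The canonical pieces of a balanced `S ⊆ U` cover `S` exactly. -/
theorem pieces_union (S : Finset ℕ) (hS : S ⊆ U) (hb : Balanced S) : (piecesOf S).biUnion id = S := by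
  ext x
  rw [Finset.mem_biUnion]
  constructor
  · rintro ⟨P, hP, hx⟩
    unfold piecesOf at hP
    rw [Finset.mem_biUnion] at hP
    obtain ⟨i, _, hP⟩ := hP
    have hci := crep_facts.1 i
    rw [Function.id_def] at hx
    unfold blockPieces at hP
    split_ifs at hP with h1 h2
    · rw [Finset.mem_singleton] at hP; rw [hP] at hx
      exact (h1 x (List.mem_toFinset.mp hx)).1
    · rw [Finset.mem_singleton] at hP; rw [hP] at hx
      rw [List.mem_toFinset, List.mem_map] at hx
      obtain ⟨t, ht, rfl⟩ := hx
      exact (h2 t ht).2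
    · rw [Finset.mem_image] at hP
      obtain ⟨t, ht, rfl⟩ := hP
      obtain ⟨htc, htS⟩ := Finset.mem_filter.mp ht
      have htc' : t ∈ coset (crep i) := List.mem_toFinset.mp htc
      have hpairs : PairsOn S (crep i) := by
        rcases (balanced_iff_blocks S hS).mp hb (crep i) hci with h | h | h
        · exact h
        · exact absurd h h1
        · exact absurd h h2
      rw [Finset.mem_insert, Finset.mem_singleton] at hx
      rcases hx with rfl | rfl
      · exact htS
      · exact (hpairs t htc').mp htS
  · intro hx
    obtain ⟨i, hi⟩ := block_cover.1 x (List.mem_toFinset.mp (hS hx))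
    have hci := crep_facts.1 i
    have hmem : ∀ P ∈ blockPieces S i, x ∈ P → ∃ P ∈ piecesOf S, x ∈ id P := by
      intro P hP hxP
      exact ⟨P, Finset.mem_biUnion.mpr ⟨i, Finset.mem_univ i, hP⟩, hxP⟩
    rcases (balanced_iff_blocks S hS).mp hb (crep i) hci with h | h | h
    · -- pairs on the block
      have hnc : ¬ CosetOn S (crep i) := by
        intro hc
        obtain ⟨a1, a2⟩ := hc (crep i) (creps_mem_coset _ hci)
        exact a2 ((h (crep i) (creps_mem_coset _ hci)).mp a1)
      have hncc : ¬ ConjCosetOn S (crep i) := by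
        intro hc
        obtain ⟨a1, a2⟩ := hc (crep i) (creps_mem_coset _ hci)
        exact a1 ((h (crep i) (creps_mem_coset _ hci)).mpr a2)
      rcases (mem_block i x).mp hi with hxc | ⟨t, ht, rfl⟩
      · apply hmem {x, conj x}
        · unfold blockPieces
          rw [if_neg hnc, if_neg hncc, Finset.mem_image]
          exact ⟨x, Finset.mem_filter.mpr ⟨List.mem_toFinset.mpr hxc, hx⟩, rfl⟩
        · simp
      · apply hmem {t, conj t}
        · unfold blockPieces
          rw [if_neg hnc, if_neg hncc, Finset.mem_image]
          exact ⟨t, Finset.mem_filter.mpr ⟨List.mem_toFinset.mpr ht, (h t ht).mpr hx⟩, rfl⟩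
        · simp
    · -- the coset on the block
      rcases (mem_block i x).mp hi with hxc | ⟨t, ht, rfl⟩
      · apply hmem (coset (crep i)).toFinset
        · unfold blockPieces; rw [if_pos h]; exact Finset.mem_singleton_self _
        · exact List.mem_toFinset.mpr hxc
      · exact absurd hx (h t ht).2
    · -- the conjugate coset on the block
      have hnc : ¬ CosetOn S (crep i) := by
        intro hc
        exact (hc (crep i) (creps_mem_coset _ hci)).2 (h (crep i) (creps_mem_coset _ hci)).2
      rcases (mem_block i x).mp hi with hxc | ⟨t, ht, rfl⟩
      · exact absurd hx (h x hxc).1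
      · apply hmem ((coset (crep i)).map conj).toFinset
        · unfold blockPieces; rw [if_neg hnc, if_pos h]; exact Finset.mem_singleton_self _
        · exact List.mem_toFinset.mpr (List.mem_map.mpr ⟨t, ht, rfl⟩)

/-- THE DECOMPOSITION: every balanced subset of `(ℤ/96)^×` (for the type `T′` of `A′`) is a DISJOINT UNION of
conjugate pairs `{s, −s}` and cosets of `H = {1, 25, 49, 73}` — the census statement of the page of Theorem F′. -/
theorem balanced_decomposition (S : Finset ℕ) (hS : S ⊆ U) (hb : Balanced S) :
    ∃ Ps : Finset (Finset ℕ), (∀ P ∈ Ps, IsPair P ∨ IsCoset P) ∧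
      (Ps : Set (Finset ℕ)).PairwiseDisjoint id ∧ Ps.biUnion id = S :=
  ⟨piecesOf S, pieces_are_pieces S, pieces_disjoint S, pieces_union S hS hb⟩


end HodgeRepro0.P5AprimeCensus
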